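import Mathlib
import Summits.NavierStokesRegularity.NavierStokesRegularity.Theorems.L3TimeExponentPincerEffSatBlowupStubParabolicConcentrationBlowup
import Summits.NavierStokesRegularity.NavierStokesRegularity.Theorems.L3TimeExponentPincerJawFullMorrey
import HarnessLib.Audit
import HarnessLib

/-!
# `L3CascadeJaw` on TIME-Type-I blow-ups, unconditionally and elementarily
# (route `L3TimeExponentPincer`, item `stmt-NavierStokesRegularity-19499`; helper file of THEOREM J′)

Helper file (cell ns-regularity-ideate, seat p2, ROUND-9), 0 `sorry`, no literature hypothesis.

On a frame solution that is Type I in time at `T` (`IsTypeIBlowup u T`: `‖u(t,x)‖ ≤ C/√(T-t)` eventually),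
the pointwise bound `‖u(t)‖₃³ ≤ ‖u(t)‖_∞ ‖u(t)‖₂² ≤ C (T-t)^{-1/2} · 2E₀` (energy inequality) gives
`∫_{T₂}^{T} ‖u‖₃^q dt ≤ const · ∫ (T-t)^{-q/6} dt < ∞` for EVERY `q < 6` (`jaw_on_typeI_elementary`,
`l3CascadeJaw_clause_on_typeI`) — an elementary, stub-free route to the clause behind the landed
`…L3TimeExponentPincerEffSatTypeIRung.l3CascadeJaw_of_noTypeII` (`NoTypeII → L3CascadeJaw`, which runs through the
ε-regularity stub chain; not restated here).

The point of recording it: the CONTENT of theorem J′ (`L3TimeExponentPincerJawFullMorrey`) is therefore exactly the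
extension from time-Type-I to the wider scaled-energy-Type-I ("full Morrey") class, where the sup-rate may be Type II.
-/

noncomputable section

namespace Summit.NavierStokesRegularity.NavierStokesRegularity.Theorems.L3TimeExponentPincerJawTypeIElementary

open MeasureTheory Set Function Filter Metric Topology
open scoped ENNReal NNReal
open Literature.Analysis.FluidPDE
open Summit.NavierStokesRegularity.NavierStokesRegularity.Theorems.L3TimeExponentPincerJawFullMorrey (eLpNorm_three_rpow_eq)

/-- `∫_{T₂}^{T} (T-t)^{-q/6} dt < ∞` for `q < 6`. -/
theorem lintegral_Ioo_rpow_sub_lt_top {T₂ T k q : ℝ} (hT₂ : T₂ < T) (hq6 : q < 6) :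
    ∫⁻ t in Ioo T₂ T, ENNReal.ofReal (k * (T - t) ^ (-(q / 6))) < ⊤ := by
  have h := (intervalIntegral.intervalIntegrable_rpow' (a := 0) (b := T - T₂)
    (by linarith : -1 < -(q / 6))).comp_sub_left T
  rw [sub_zero, sub_sub_cancel] at h
  have h' : IntegrableOn (fun t : ℝ => k * (T - t) ^ (-(q / 6))) (Ioo T₂ T) :=
    ((intervalIntegrable_iff_integrableOn_Ioo_of_le hT₂.le).1 h.symm).const_mul _
  calc ∫⁻ t in Ioo T₂ T, ENNReal.ofReal (k * (T - t) ^ (-(q / 6)))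
      ≤ ∫⁻ t in Ioo T₂ T, ‖k * (T - t) ^ (-(q / 6))‖ₑ := lintegral_ofReal_le_lintegral_enorm _
    _ < ⊤ := h'.2

/-- **Elementary, stub-free**: a TIME-Type-I frame blow-up (`|u(x,t)| ≤ C/√(T-t)` eventually) lies in
`L^q_t L³_x` up to `T` for every `0 ≤ q < 6`, by `‖u(t)‖₃³ ≤ ‖u(t)‖_∞ ‖u(t)‖₂² ≤ C·2E₀·(T-t)^{-1/2}`.
(So on time-Type-I the clause of `L3CascadeJaw` is trivial; the content of J′ is the extension to the
full-Morrey = Type-II-RATE class and the endpoint `q = 6`.) -/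
theorem jaw_on_typeI_elementary {ν T : ℝ} (hν : 0 < ν) (hT : 0 < T)
    {u : ℝ → (EuclideanSpace ℝ (Fin 3)) → (EuclideanSpace ℝ (Fin 3))} {p : ℝ → (EuclideanSpace ℝ (Fin 3)) → ℝ}
    (hcl : IsClassicalNSSolutionOn (Ico 0 T) ν 0 u p) (hLH : IsLerayHopfOn T ν 0 (u 0) u)
    (hTI : IsTypeIBlowup u T) {q : ℝ} (hq0 : 0 ≤ q) (hq6 : q < 6) :
    ∃ T₂ ∈ Ioo 0 T, (∫⁻ t in Ioo T₂ T, eLpNorm (u t) 3 volume ^ q) < ⊤ := by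
  have _ := hcl
  obtain ⟨C, hC⟩ := hTI
  obtain ⟨l, hlT, hl⟩ := mem_nhdsLT_iff_exists_Ioo_subset.1 hC
  set e₀ : ℝ := 2 * VectorCalculus.kineticEnergy (u 0) with he₀
  have he₀nn : 0 ≤ e₀ := mul_nonneg zero_le_two (kineticEnergy_nonneg _)
  set C' : ℝ := max C 0 with hC'
  have hC'0 : 0 ≤ C' := le_max_right _ _
  set T₂ : ℝ := max l (T / 2) with hT₂
  have hT₂mem : T₂ ∈ Ioo 0 T := ⟨lt_max_of_lt_right (by linarith), max_lt hlT (by linarith)⟩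
  refine ⟨T₂, hT₂mem, ?_⟩
  -- slice bound
  have hslice : ∀ t ∈ Ioo T₂ T, eLpNorm (u t) 3 volume ^ q ≤
      ENNReal.ofReal ((C' * e₀) ^ (q / 3) * (T - t) ^ (-(q / 6))) := by
    intro t ht
    have htl : t ∈ Ioo l T := ⟨lt_of_le_of_lt (le_max_left _ _) ht.1, ht.2⟩
    have ht0 : 0 < t := hT₂mem.1.trans ht.1
    have hs : 0 < T - t := sub_pos.2 ht.2
    have hsq : 0 < Real.sqrt (T - t) := Real.sqrt_pos.2 hs
    have hpt : ∀ x, ‖u t x‖ ≤ C' / Real.sqrt (T - t) := fun x =>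
      (hl htl x).trans (div_le_div_of_nonneg_right (le_max_left _ _) hsq.le)
    have hE : ∫⁻ y, ‖u t y‖ₑ ^ 2 ≤ ENNReal.ofReal e₀ := hLH.lintegral_enorm_sq_le hν.le ⟨ht0.le, ht.2.le⟩
    have h3 : ∫⁻ y, ‖u t y‖ₑ ^ (3 : ℕ) ≤ ENNReal.ofReal (C' / Real.sqrt (T - t) * e₀) := by
      calc ∫⁻ y, ‖u t y‖ₑ ^ (3 : ℕ) = ∫⁻ y, ‖u t y‖ₑ * ‖u t y‖ₑ ^ 2 :=
            lintegral_congr fun y => by rw [pow_succ']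
        _ ≤ ∫⁻ y, ENNReal.ofReal (C' / Real.sqrt (T - t)) * ‖u t y‖ₑ ^ 2 := by
            refine lintegral_mono fun y => mul_le_mul_of_nonneg_right ?_ bot_le
            rw [← ofReal_norm]
            exact ENNReal.ofReal_le_ofReal (hpt y)
        _ = ENNReal.ofReal (C' / Real.sqrt (T - t)) * ∫⁻ y, ‖u t y‖ₑ ^ 2 :=
            lintegral_const_mul' _ _ ENNReal.ofReal_ne_top
        _ ≤ ENNReal.ofReal (C' / Real.sqrt (T - t)) * ENNReal.ofReal e₀ :=
            mul_le_mul_of_nonneg_left hE bot_le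
        _ = ENNReal.ofReal (C' / Real.sqrt (T - t) * e₀) := (ENNReal.ofReal_mul (by positivity)).symm
    rw [eLpNorm_three_rpow_eq]
    calc (∫⁻ y, ‖u t y‖ₑ ^ (3 : ℕ)) ^ (q / 3)
        ≤ (ENNReal.ofReal (C' / Real.sqrt (T - t) * e₀)) ^ (q / 3) :=
          ENNReal.rpow_le_rpow h3 (by positivity)
      _ = ENNReal.ofReal ((C' * e₀) ^ (q / 3) * (T - t) ^ (-(q / 6))) := by
          rw [ENNReal.ofReal_rpow_of_nonneg (by positivity) (by positivity)]
          congr 1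
          rw [Real.sqrt_eq_rpow, div_eq_mul_inv, ← Real.rpow_neg hs.le,
            show C' * (T - t) ^ (-(1 / 2 : ℝ)) * e₀ = (C' * e₀) * (T - t) ^ (-(1 / 2 : ℝ)) by ring,
            Real.mul_rpow (by positivity) (Real.rpow_nonneg hs.le _), ← Real.rpow_mul hs.le]
          congr 2
          ring
  calc ∫⁻ t in Ioo T₂ T, eLpNorm (u t) 3 volume ^ q
      ≤ ∫⁻ t in Ioo T₂ T, ENNReal.ofReal ((C' * e₀) ^ (q / 3) * (T - t) ^ (-(q / 6))) :=
        setLIntegral_mono' measurableSet_Ioo hslice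
    _ < ⊤ := lintegral_Ioo_rpow_sub_lt_top hT₂mem.2 hq6

/-- Hence the clause of `L3CascadeJaw` (`q ∈ (4,5)`) holds on every time-Type-I frame blow-up,
UNCONDITIONALLY (no stub). -/
theorem l3CascadeJaw_clause_on_typeI :
    ∀ q : ℝ, 4 < q → q < 5 → ∀ (ν T : ℝ), 0 < ν → 0 < T → ∀ (u : ℝ → (EuclideanSpace ℝ (Fin 3)) → (EuclideanSpace ℝ (Fin 3))) (p : ℝ → (EuclideanSpace ℝ (Fin 3)) → ℝ),
      IsClassicalNSSolutionOn (Ico 0 T) ν 0 u p → IsLerayHopfOn T ν 0 (u 0) u →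
      HasRapidSpatialDecay (u 0) → IsTypeIBlowup u T →
        ∃ T₂ ∈ Ioo 0 T, (∫⁻ t in Ioo T₂ T, eLpNorm (u t) 3 volume ^ q) < ⊤ :=
  fun q hq4 hq5 ν T hν hT u p hcl hLH _ hTI =>
    jaw_on_typeI_elementary hν hT hcl hLH hTI (by linarith) (by linarith)


end Summit.NavierStokesRegularity.NavierStokesRegularity.Theorems.L3TimeExponentPincerJawTypeIElementary

end
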